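import Mathlib
import HarnessLib
import Literature.AlgebraicGeometry.Resolution.AugmentationIdeal
import Literature.AlgebraicGeometry.Resolution.RegularQuotientIdeal
import Literature.AlgebraicGeometry.Resolution.StrictNormalCrossingsOpen
import Literature.AlgebraicGeometry.Resolution.RsopMonomialIdeals

/-!
# Tame fixed loci on regular local rings are permissible centres, in EVERY dimension
# (crux `WildQuotients.WildQuotientResolution`, stub `stub_phaseZeroHighDim`: regular tame carrier centres)

Crux stmt-ResolutionOfSingularities-15640 (`WildQuotientResolution`), registered stub `stub_phaseZeroHighDim`
(= Phase 0 for `dim X′ ≥ 3`: a `G`-equivariant proper birational REGULAR model on which every inertia group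
is p-closed). Every Phase-0 design in the tree blows up, `G`-equivariantly, REGULAR `G_Z`-stable centres of
the regular `X′` and needs them to be cut out, at each of their points, by PART OF A REGULAR SYSTEM OF
PARAMETERS (`IsRsopPart`; this is the permissibility input `hc : IsRsopPart c` of
✓`CentreBlowupInertia.hasNormalSylow_inertia_of_regularCentreBlowup`, ✓`CurveBlowupNpc…`, ✓`CurveStep.curveMove`):
the dimension-3 round design of hand 6 g0 (evidence PHASE0-DIM3-TERMINATION.md on the item) cures the
non-termination of the naive «NPC points + NPC curves» game by blowing up CARRIER loci — fixed loci of
subgroups of the inertia — and a Gabber-style tame toroidalisation in arbitrary dimension blows up fixed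
loci of the TAME (order prime to `p`) subgroups `H ≤ G`. For tame `H` these centres are regular in every
dimension; the involution case (`H = ℤ/2`, `2 ∈ R×`) is ✓`InvolutionExit.isRegularLocalRing_quotient_augIdeal`
(`Theorems/…InvolutionFixedLocusRegular.lean`). This file proves the general statement, for an arbitrary
finite group of invertible order acting on a regular local ring of any dimension:

**Theorem** (`exists_isRsopPart_span_eq_iSup_augIdeal`, `isRegularLocalRing_quotient_iSup_augIdeal`). Let
`(R, 𝔪, κ)` be a regular local ring, `I` a finite group whose order is a unit of `R`, and
`τ : I →* (R ≃+* R)` an action fixing the closed point (`I_{τ g} ≤ 𝔪` for all `g`, i.e. `τ` is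
residue-trivial — the situation of an inertia group). Then the ideal of the fixed locus
`𝔞 = ⨆ g, I_{τ g} = (τ g r − r : g ∈ I, r ∈ R)` is generated by finitely many elements `f₁, …, f_c` of
trace zero (`∑ g, τ g fᵢ = 0`) whose images in `𝔪/𝔪²` are linearly independent — a part of a regular
system of parameters — so `R ⧸ 𝔞` is a regular local ring and `c + dim R⧸𝔞 = dim R`.

Proof (Reynolds operator; the regular-local-ring form of Fogarty / Iversen / Milne's Lemmas 13.4–13.6,
there for smooth varieties over an algebraically closed field): with `n = |I|`, `u n = 1`, every `x` is
`u ∑ g, τ g x + u ∑ g, (x − τ g x)`, so `𝔞` is the ideal generated by the set `K` of TRACE-ZERO elements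
(`iSup_augIdeal_eq_span`), and `K ⊆ 𝔪`. Select `f₁, …, f_c ∈ K` whose differentials form a basis of the
image of `K` in `𝔪/𝔪²` (tree `exists_linearIndependent_of_subset_maximalIdeal`). KEY ESTIMATES:
(i) for `b ∈ 𝔪²`, `∑ g, (b − τ g b) ∈ 𝔪·𝔞` (`a c − τ(a c) = a (c − τ c) + τ c · (a − τ a)`);
(ii) for `y` in the `R`-span of trace-zero elements, `∑ g, τ g y ∈ 𝔪·𝔞`
(`∑ τ(a) τ(f) = a ∑ τ f + ∑ (τ a − a) τ f`). Hence a trace-zero `x = y + b` (`y ∈ (f)`, `b ∈ 𝔪²`) equals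
`(y − u ∑ τ y) + u ∑ ((x − y) − τ (x − y)) ∈ (f) + 𝔪·𝔞`, and `𝔞 = (f)` by Nakayama; Matsumura 14.2
(tree `isRegularLocalRing_quotient_span_image_of_linearIndependent_toCotangent`, `exists_extend_to_rsop`)
finishes. The last section records that a subgroup of order prime to the residue characteristic has
invertible order (`isUnit_natCast_of_not_dvd`), the form in which tame subgroups of inertia groups occur.

[OURS · crux stmt-ResolutionOfSingularities-15640 · helper toward `stub_phaseZeroHighDim` (permissibility of
tame carrier centres in every dimension; NOT a proof of the stub); classical local algebra
(Fogarty 1973; Iversen 1972; Edixhoven 1992 Prop. 3.4 and Conrad–Gabber–Prasad A.8.10 (2) are the SMOOTH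
relative forms, ✓`Literature.AlgebraicGeometry.GroupActions.…_holds`; Milne, *Algebraic Groups*, 13.4–13.6),
counted 0; AI-level work, weaker than expert review.] [folklore]

* `sum_apply_apply`, `apply_sum_apply`, `sum_apply_sub_self` — the trace `x ↦ ∑ g, τ g x` is
  `τ`-invariant and kills the generators `τ h x − x`;
* `sub_mul_sum_mem_iSup`, `mem_iSup_of_sum_eq_zero`, `iSup_augIdeal_eq_span` — `x − u·tr x ∈ 𝔞`; the
  fixed-locus ideal is generated by the trace-zero elements (order invertible);
* `apply_mem_maximalIdeal`, `mem_maximalIdeal_of_sum_eq_zero`, `sum_sub_apply_mem_mul_of_mem_sq`,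
  `sum_apply_mem_mul_of_mem_span` — the two key estimates;
* `exists_generators_linearIndependent`, `isRegularLocalRing_quotient_iSup_augIdeal`,
  `exists_isRsopPart_span_eq_iSup_augIdeal`, `isRegularLocalRing_quotient_and_exists_finset` — the theorem;
* `isUnit_natCast_of_not_dvd`, `exists_isRsopPart_of_coprime` — the residue-characteristic form.
-/

-- single-problem summit: the doubled namespace component `ResolutionOfSingularities` is forced
set_option linter.dupNamespace false

noncomputable section

namespace Summit.ResolutionOfSingularities.ResolutionOfSingularities.Theorems.WildQuotientResolution.TameFixedLocus

open IsLocalRing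
open Literature.AlgebraicGeometry.Resolution

universe u

/-! ## The trace and the fixed-locus ideal -/

section Trace

variable {R : Type*} [CommRing R] {I : Type*} [Group I] [Fintype I] (τ : I →* (R ≃+* R))

/-- The trace `∑ g, τ g x` is unchanged by first applying `τ h` (reindex `g ↦ g h`). [folklore] -/
theorem sum_apply_apply (h : I) (x : R) : ∑ g, τ g (τ h x) = ∑ g, τ g x := by
  have e : ∀ g, τ g (τ h x) = τ (g * h) x := fun g => by rw [map_mul, RingAut.mul_apply]
  simp_rw [e]
  exact Fintype.sum_equiv (Equiv.mulRight h) _ _ fun g => rfl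

/-- The trace `∑ g, τ g x` is `τ`-invariant (reindex `g ↦ h g`). [folklore] -/
theorem apply_sum_apply (h : I) (x : R) : τ h (∑ g, τ g x) = ∑ g, τ g x := by
  rw [map_sum]
  have e : ∀ g, τ h (τ g x) = τ (h * g) x := fun g => by rw [map_mul, RingAut.mul_apply]
  simp_rw [e]
  exact Fintype.sum_equiv (Equiv.mulLeft h) _ _ fun g => rfl

/-- The generators `τ h x − x` of the fixed-locus ideal have trace zero. [folklore] -/
theorem sum_apply_sub_self (h : I) (x : R) : ∑ g, τ g (τ h x - x) = 0 := by
  simp_rw [map_sub]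
  rw [Finset.sum_sub_distrib, sum_apply_apply, sub_self]

/-- If `u · |I| = 1` in `R`, then `x − u ∑ g, τ g x = u ∑ g, (x − τ g x)` lies in the fixed-locus ideal
`⨆ g, I_{τ g}`. [folklore] -/
theorem sub_mul_sum_mem_iSup {u : R} (hu : u * (Fintype.card I : R) = 1) (x : R) :
    x - u * ∑ g, τ g x ∈ ⨆ g, augIdeal (τ g) := by
  have hx : x = u * ∑ _g : I, x := by
    rw [Finset.sum_const, Finset.card_univ, nsmul_eq_mul, ← mul_assoc, hu, one_mul]
  have e : x - u * ∑ g, τ g x = u * ∑ g, (x - τ g x) := by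
    rw [Finset.sum_sub_distrib, mul_sub, ← hx]
  rw [e]
  refine Ideal.mul_mem_left _ _ (Ideal.sum_mem _ fun g _ => ?_)
  have h1 : x - τ g x = -(τ g x - x) := by ring
  rw [h1]
  exact neg_mem (Submodule.mem_iSup_of_mem g (sub_mem_augIdeal (τ g) x))

/-- If `u · |I| = 1` in `R`, every trace-zero element lies in the fixed-locus ideal. [folklore] -/
theorem mem_iSup_of_sum_eq_zero {u : R} (hu : u * (Fintype.card I : R) = 1) {x : R}
    (hx : ∑ g, τ g x = 0) : x ∈ ⨆ g, augIdeal (τ g) := by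
  have h := sub_mul_sum_mem_iSup τ hu x
  rwa [hx, mul_zero, sub_zero] at h

/-- **The fixed-locus ideal is generated by the trace-zero elements** when the order of the group is
invertible: `⨆ g, I_{τ g} = ({x | ∑ g, τ g x = 0})`. [folklore] -/
theorem iSup_augIdeal_eq_span {u : R} (hu : u * (Fintype.card I : R) = 1) :
    (⨆ g, augIdeal (τ g)) = Ideal.span {x : R | ∑ g, τ g x = 0} := by
  apply le_antisymm
  · refine iSup_le fun h => ?_
    rw [augIdeal_def]
    refine Ideal.span_mono ?_
    rintro _ ⟨b, rfl⟩
    exact sum_apply_sub_self τ h b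
  · exact Ideal.span_le.mpr fun x hx => mem_iSup_of_sum_eq_zero τ hu hx

end Trace

/-! ## The closed point fixed: the two key estimates -/

section Local

variable {R : Type*} [CommRing R] [IsLocalRing R] {I : Type*} [Group I] (τ : I →* (R ≃+* R))

/-- If the fixed locus contains the closed point (`⨆ g, I_{τ g} ≤ 𝔪`), every `τ h` maps `𝔪` into
`𝔪`. [folklore] -/
theorem apply_mem_maximalIdeal (hm : (⨆ g, augIdeal (τ g)) ≤ maximalIdeal R) (h : I) {x : R}
    (hx : x ∈ maximalIdeal R) : τ h x ∈ maximalIdeal R := by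
  have e : τ h x = x + (τ h x - x) := by ring
  rw [e]
  exact add_mem hx (hm (Submodule.mem_iSup_of_mem h (sub_mem_augIdeal (τ h) x)))

variable [Fintype I]

/-- Trace-zero elements lie in `𝔪` (closed point fixed, order invertible). [folklore] -/
theorem mem_maximalIdeal_of_sum_eq_zero (hm : (⨆ g, augIdeal (τ g)) ≤ maximalIdeal R)
    {u : R} (hu : u * (Fintype.card I : R) = 1) {x : R} (hx : ∑ g, τ g x = 0) :
    x ∈ maximalIdeal R :=
  hm (mem_iSup_of_sum_eq_zero τ hu hx)

/-- **Key estimate (i)**: for `b ∈ 𝔪²`, `∑ g, (b − τ g b) ∈ 𝔪 · ⨆ g, I_{τ g}` — on products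
`a c − τ(a c) = a (c − τ c) + τ c · (a − τ a)`. [folklore] -/
theorem sum_sub_apply_mem_mul_of_mem_sq (hm : (⨆ g, augIdeal (τ g)) ≤ maximalIdeal R) {b : R}
    (hb : b ∈ maximalIdeal R ^ 2) :
    ∑ g, (b - τ g b) ∈ maximalIdeal R * ⨆ g, augIdeal (τ g) := by
  rw [pow_two] at hb
  refine Ideal.sum_mem _ fun g _ => ?_
  refine Submodule.mul_induction_on hb ?_ ?_
  · intro a ha c hc
    have e : a * c - τ g (a * c) = a * (c - τ g c) + τ g c * (a - τ g a) := by rw [map_mul]; ring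
    rw [e]
    refine add_mem (Ideal.mul_mem_mul ha ?_)
      (Ideal.mul_mem_mul (apply_mem_maximalIdeal τ hm g hc) ?_)
    · have h1 : c - τ g c = -(τ g c - c) := by ring
      rw [h1]
      exact neg_mem (Submodule.mem_iSup_of_mem g (sub_mem_augIdeal (τ g) c))
    · have h1 : a - τ g a = -(τ g a - a) := by ring
      rw [h1]
      exact neg_mem (Submodule.mem_iSup_of_mem g (sub_mem_augIdeal (τ g) a))
  · intro x y hx hy
    have e : x + y - τ g (x + y) = (x - τ g x) + (y - τ g y) := by rw [map_add]; ring
    rw [e]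
    exact add_mem hx hy

/-- **Key estimate (ii)**: if `y` lies in the ideal generated by a set of trace-zero elements, then its
trace `∑ g, τ g y` lies in `𝔪 · ⨆ g, I_{τ g}` — on multiples
`∑ τ(a) τ(x) = a ∑ τ x + ∑ τ x · (τ a − a)`. [folklore] -/
theorem sum_apply_mem_mul_of_mem_span (hm : (⨆ g, augIdeal (τ g)) ≤ maximalIdeal R)
    {u : R} (hu : u * (Fintype.card I : R) = 1) {s : Set R} (hs : ∀ f ∈ s, ∑ g, τ g f = 0)
    {y : R} (hy : y ∈ Ideal.span s) :
    ∑ g, τ g y ∈ maximalIdeal R * ⨆ g, augIdeal (τ g) := by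
  induction hy using Submodule.span_induction with
  | mem f hf => rw [hs f hf]; exact zero_mem _
  | zero => simp only [map_zero, Finset.sum_const_zero]; exact zero_mem _
  | add x y _ _ hx hy => simp_rw [map_add]; rw [Finset.sum_add_distrib]; exact add_mem hx hy
  | smul a x hx' hx =>
    have hsm : Ideal.span s ≤ maximalIdeal R :=
      Ideal.span_le.mpr fun f hf => mem_maximalIdeal_of_sum_eq_zero τ hm hu (hs f hf)
    have hxm : x ∈ maximalIdeal R := hsm hx'
    have e : ∑ g, τ g (a • x) = a * ∑ g, τ g x + ∑ g, τ g x * (τ g a - a) := by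
      simp_rw [smul_eq_mul, map_mul]
      rw [Finset.mul_sum, ← Finset.sum_add_distrib]
      exact Finset.sum_congr rfl fun g _ => by ring
    rw [e]
    exact add_mem (Ideal.mul_mem_left _ _ hx)
      (Ideal.sum_mem _ fun g _ => Ideal.mul_mem_mul (apply_mem_maximalIdeal τ hm g hxm)
        (Submodule.mem_iSup_of_mem g (sub_mem_augIdeal (τ g) a)))

end Local

/-! ## The theorem: tame fixed loci are cut out by parts of regular systems of parameters -/

section Regular

variable {R : Type u} [CommRing R] [IsRegularLocalRing R] {I : Type*} [Group I] [Finite I]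
  (τ : I →* (R ≃+* R))

/-- **The fixed-locus ideal is generated by trace-zero elements with linearly independent
differentials** (`(R, 𝔪)` regular local, `I` finite of invertible order, `τ` fixing the closed point):
there are `f₁, …, f_c ∈ ⨆ g, I_{τ g}`, `fᵢ ∈ 𝔪`, with `⨆ g, I_{τ g} = (f₁, …, f_c)` whose images in
`𝔪/𝔪²` are linearly independent. (Reynolds operator + Nakayama; see the module docstring.) [folklore] -/
theorem exists_generators_linearIndependent (hI : IsUnit ((Nat.card I : ℕ) : R))
    (hm : (⨆ g, augIdeal (τ g)) ≤ maximalIdeal R) :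
    ∃ (c : ℕ) (f : Fin c → R) (hf : ∀ i, f i ∈ maximalIdeal R),
      (∀ i, f i ∈ ⨆ g, augIdeal (τ g)) ∧
      Ideal.span (Set.range f) = ⨆ g, augIdeal (τ g) ∧
      LinearIndependent (ResidueField R) fun i => (maximalIdeal R).toCotangent ⟨f i, hf i⟩ := by
  classical
  have : Fintype I := Fintype.ofFinite I
  obtain ⟨u, hu⟩ := hI.exists_left_inv
  rw [Nat.card_eq_fintype_card] at hu
  set m := maximalIdeal R with hmdef
  set J : Ideal R := ⨆ g, augIdeal (τ g) with hJ
  set K : Set R := {y : R | ∑ g, τ g y = 0} with hK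
  have hKm : K ⊆ m := fun y hy => mem_maximalIdeal_of_sum_eq_zero τ hm hu hy
  obtain ⟨c, f, hfK, hli, hspan⟩ := exists_linearIndependent_of_subset_maximalIdeal K hKm
  have hf : ∀ i, f i ∈ m := fun i => hKm (hfK i)
  have hf0 : ∀ i, ∑ g, τ g (f i) = 0 := fun i => hfK i
  set Y : Ideal R := Ideal.span (Set.range f) with hY
  have hJK : J = Ideal.span K := iSup_augIdeal_eq_span τ hu
  have hYJ : Y ≤ J := by
    rw [hJK]
    exact Ideal.span_mono (by rintro _ ⟨i, rfl⟩; exact hfK i)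
  -- every trace-zero `x` is `y + b` with `y ∈ Y`, `b ∈ 𝔪²`
  have hstep : ∀ x ∈ K, ∃ y ∈ Y, x - y ∈ m ^ 2 := by
    intro x hx
    let f' : Fin c → m := fun i => ⟨f i, hf i⟩
    have hdx : m.toCotangent ⟨x, hKm hx⟩ ∈
        Submodule.span (ResidueField R) (Set.range fun i => m.toCotangent (f' i)) := by
      rw [hspan]
      exact Submodule.subset_span ⟨⟨x, hx⟩, rfl⟩
    have hdxR : m.toCotangent ⟨x, hKm hx⟩ ∈
        Submodule.span R (Set.range fun i => m.toCotangent (f' i)) := by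
      rw [← Submodule.restrictScalars_span R (ResidueField R) Ideal.Quotient.mk_surjective]
      exact hdx
    rw [Set.range_comp', ← Submodule.map_span] at hdxR
    obtain ⟨y, hy, hyx⟩ := hdxR
    refine ⟨(y : R), ?_, ?_⟩
    · have h1 : (m.subtype) y ∈ (Submodule.span R (Set.range f')).map m.subtype :=
        Submodule.mem_map_of_mem hy
      rw [Submodule.map_span, ← Set.range_comp] at h1
      exact h1
    · exact (Ideal.toCotangent_eq m).mp hyx.symm
  -- hence every trace-zero element lies in `Y ⊔ 𝔪 • J`, so `J ≤ Y ⊔ 𝔪 • J`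
  have hKle : ∀ x ∈ K, x ∈ Y ⊔ m • J := by
    intro x hx
    obtain ⟨y, hyY, hxy⟩ := hstep x hx
    have hx0 : ∑ k, τ k x = 0 := hx
    -- `x = (y − u·tr y) + u ∑ ((x − y) − τ (x − y))`
    have e : x = (y - u * ∑ k, τ k y) + u * ∑ k, ((x - y) - τ k (x - y)) := by
      have h1 : ∑ k, ((x - y) - τ k (x - y)) =
          (Fintype.card I : R) * (x - y) - (∑ k, τ k x - ∑ k, τ k y) := by
        simp_rw [map_sub]
        rw [Finset.sum_sub_distrib, Finset.sum_const, Finset.card_univ, nsmul_eq_mul,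
          Finset.sum_sub_distrib]
      rw [h1, hx0, zero_sub]
      linear_combination (y - x) * hu
    rw [e]
    refine add_mem (sub_mem (Ideal.mem_sup_left hyY) (Ideal.mem_sup_right ?_))
      (Ideal.mem_sup_right (Ideal.mul_mem_left _ _ ?_))
    · rw [smul_eq_mul]
      exact Ideal.mul_mem_left _ _ (sum_apply_mem_mul_of_mem_span τ hm hu
        (s := Set.range f) (by rintro _ ⟨i, rfl⟩; exact hf0 i) hyY)
    · rw [smul_eq_mul]
      exact sum_sub_apply_mem_mul_of_mem_sq τ hm hxy
  have hle : J ≤ Y ⊔ m • J :=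
    calc J = Ideal.span K := hJK
      _ ≤ Y ⊔ m • J := Ideal.span_le.mpr fun x hx => hKle x hx
  have hfg : J.FG := IsNoetherian.noetherian J
  have hJY : J ≤ Y :=
    Submodule.le_of_le_smul_of_le_jacobson_bot hfg
      (IsLocalRing.jacobson_eq_maximalIdeal ⊥ bot_ne_top).ge hle
  exact ⟨c, f, hf, fun i => hYJ (Ideal.subset_span ⟨i, rfl⟩), le_antisymm hYJ hJY, hli⟩

/-- **The fixed locus of a finite group of invertible order on a regular local ring is regular**: for
`(R, 𝔪)` regular local, `I` finite with `|I| ∈ R×` and `τ : I →* (R ≃+* R)` fixing the closed point,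
`R ⧸ ⨆ g, I_{τ g}` is a regular local ring (Matsumura 14.2). The case `I = ℤ/2` is
✓`InvolutionExit.isRegularLocalRing_quotient_augIdeal`. [folklore] -/
theorem isRegularLocalRing_quotient_iSup_augIdeal (hI : IsUnit ((Nat.card I : ℕ) : R))
    (hm : (⨆ g, augIdeal (τ g)) ≤ maximalIdeal R) :
    IsRegularLocalRing (R ⧸ ⨆ g, augIdeal (τ g)) := by
  obtain ⟨c, f, hf, -, hspan, hli⟩ := exists_generators_linearIndependent τ hI hm
  have h := isRegularLocalRing_quotient_span_image_of_linearIndependent_toCotangent f hf hli Set.univ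
  rw [Set.image_univ, hspan] at h
  exact h

/-- **Tame fixed loci are permissible centres**: the fixed-locus ideal `⨆ g, I_{τ g}` of a finite group
of invertible order acting on a regular local ring and fixing the closed point is generated by a PART OF
A REGULAR SYSTEM OF PARAMETERS (`IsRsopPart`) — the permissibility input of the equivariant centre
blow-ups of Phase 0, in every dimension. [folklore] -/
theorem exists_isRsopPart_span_eq_iSup_augIdeal (hI : IsUnit ((Nat.card I : ℕ) : R))
    (hm : (⨆ g, augIdeal (τ g)) ≤ maximalIdeal R) :
    ∃ (c : ℕ) (f : Fin c → R), (∀ i, f i ∈ ⨆ g, augIdeal (τ g)) ∧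
      Ideal.span (Set.range f) = (⨆ g, augIdeal (τ g)) ∧ IsRsopPart f := by
  obtain ⟨c, f, hf, hfJ, hspan, hli⟩ := exists_generators_linearIndependent τ hI hm
  obtain ⟨e, y, hdim, hsp⟩ := exists_extend_to_rsop f hf
    ((linearIndependent_toCotangent_iff_forall_mem f hf).mp hli)
  exact ⟨c, f, hfJ, hspan, ‹IsRegularLocalRing R›, e, y, hdim, hsp⟩

/-- **Summary with the dimension count**: `R ⧸ ⨆ g, I_{τ g}` is regular local, and the fixed-locus
ideal is generated by a finite set `s` of its elements with `#s + dim (R ⧸ ⨆ g, I_{τ g}) = dim R`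
(`s` = a part of a regular system of parameters; `#s` is the codimension of the fixed locus).
[folklore] -/
theorem isRegularLocalRing_quotient_and_exists_finset (hI : IsUnit ((Nat.card I : ℕ) : R))
    (hm : (⨆ g, augIdeal (τ g)) ≤ maximalIdeal R) :
    IsRegularLocalRing (R ⧸ ⨆ g, augIdeal (τ g)) ∧
      ∃ s : Finset R, (↑s : Set R) ⊆ ↑(⨆ g, augIdeal (τ g)) ∧
        Ideal.span (s : Set R) = (⨆ g, augIdeal (τ g)) ∧
        (s.card : WithBot ℕ∞) + ringKrullDim (R ⧸ ⨆ g, augIdeal (τ g)) = ringKrullDim R := by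
  classical
  refine ⟨isRegularLocalRing_quotient_iSup_augIdeal τ hI hm, ?_⟩
  obtain ⟨c, f, hfJ, hspan, hrsop⟩ := exists_isRsopPart_span_eq_iSup_augIdeal τ hI hm
  refine ⟨Finset.univ.image f, ?_, ?_, ?_⟩
  · intro y hy
    obtain ⟨i, -, rfl⟩ := Finset.mem_image.mp hy
    exact hfJ i
  · rw [Finset.coe_image, Finset.coe_univ, Set.image_univ, hspan]
  · rw [Finset.card_image_of_injective _ hrsop.injective, Finset.card_univ, Fintype.card_fin,
      ← hspan, add_comm]
    exact hrsop.ringKrullDim_quotient_add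

end Regular

/-! ## Subgroups of order prime to the residue characteristic -/

section Coprime

/-- In a local ring of residue characteristic `p`, a natural number not divisible by `p` is a unit.
[folklore] -/
theorem isUnit_natCast_of_not_dvd {R : Type*} [CommRing R] [IsLocalRing R] (p : ℕ)
    [CharP (ResidueField R) p] {n : ℕ} (hn : ¬ p ∣ n) : IsUnit ((n : ℕ) : R) := by
  by_contra h
  have hmem : (n : R) ∈ maximalIdeal R := (IsLocalRing.mem_maximalIdeal _).mpr h
  have h0 : ((n : ℕ) : ResidueField R) = 0 := by
    rw [← map_natCast (residue R), residue_eq_zero_iff]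
    exact hmem
  exact hn ((CharP.cast_eq_zero_iff (ResidueField R) p n).mp h0)

variable {R : Type u} [CommRing R] [IsRegularLocalRing R] {I : Type*} [Group I] [Finite I]
  (τ : I →* (R ≃+* R))

/-- **Tame carrier centres, residue-characteristic form**: on a regular local ring of residue
characteristic `p` (a prime), the fixed-locus ideal of a finite group of order PRIME TO `p` fixing the
closed point is generated by a part of a regular system of parameters, and the quotient is regular
local — the form in which tame subgroups `H` of an inertia group (`|H|` coprime to `p`) supply regular
`H`-stable centres of Phase 0 in every dimension. [folklore] -/
theorem exists_isRsopPart_of_coprime (p : ℕ) [Fact p.Prime] [CharP (ResidueField R) p]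
    (hcop : (Nat.card I).Coprime p) (hm : (⨆ g, augIdeal (τ g)) ≤ maximalIdeal R) :
    IsRegularLocalRing (R ⧸ ⨆ g, augIdeal (τ g)) ∧
      ∃ (c : ℕ) (f : Fin c → R), (∀ i, f i ∈ ⨆ g, augIdeal (τ g)) ∧
        Ideal.span (Set.range f) = (⨆ g, augIdeal (τ g)) ∧ IsRsopPart f := by
  have hp : p.Prime := Fact.out
  have hI : IsUnit ((Nat.card I : ℕ) : R) :=
    isUnit_natCast_of_not_dvd p ((Nat.Prime.coprime_iff_not_dvd hp).mp hcop.symm)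
  exact ⟨isRegularLocalRing_quotient_iSup_augIdeal τ hI hm,
    exists_isRsopPart_span_eq_iSup_augIdeal τ hI hm⟩

end Coprime

end Summit.ResolutionOfSingularities.ResolutionOfSingularities.Theorems.WildQuotientResolution.TameFixedLocus

end
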